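import Summits.CriticalPhenomena.PercolationContinuityZ3.Theorems.Transplant.SectorSlabOwnCriticalPoint
import Summits.CriticalPhenomena.PercolationContinuityZ3.Theorems.Transplant.RationalHalfSlabDesign
import HarnessLib

/-!
# Sector-slabs around a QUADRANT with two pockets
# `ℚℙ_{κW,κS} = {x ∈ S_k | (x₂ ≥ 0 ∨ −x₂ ≤ κW·x₁) ∧ (x₁ ≥ 0 ∨ −x₁ ≤ κS·x₂)}` (`κW, κS > 0`) — the station design, I: station and faces

builds on p205010 (kernel theorem, internal audit signed; external expert review pending) — NOT used in this file.
Lane `prim-bschramm`, seat `prim-bschramm-p2` (gen 23; class C1b, METHOD = input substitution; memo `HOME/bschramm/P2-LATTICES.md` §84);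
helper file (`--supports stmt-CriticalPhenomena-4575 --as helper`).  `ℚℙ` = NE quadrant `{x₁, x₂ ≥ 0}` ∪ north-west pocket `{x₂ < 0 ≤ x₁, |x₂| ≤ κW x₁}`
∪ south-east pocket `{x₁ < 0 ≤ x₂, |x₁| ≤ κS x₂}`: the slab cut by the planar sector of aperture `90° + arctan κW + arctan κS` containing BOTH axis
directions `+e₁, +e₂` in its interior — CONVEX for `κWκS < 1`, REFLEX (excluded cone containing the two other axis directions) for `κWκS > 1`.
With an integer `m ≥ 2`, `mκW ≥ 1`, `mκS ≥ 1`: station `Ω = (0, m(4N+6), −(4N+6))` (in the NW pocket), sweep to `Z = (m+2)(2N+4)`, top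
`T = m(5N+8) + 4N+7`, arms `steepSetM (4m)` (slope `1/(4m)`), window `M = k + (m+2)(5N+8)`; the top and right faces lean `+e₂` (`ℚℙ` is closed under
`+e₁, +e₂`), the left face (NW pocket, `κW u₁ ≥ N+1`) leans `−e₂` with slope `≤ κW`; the bottom face (SE pocket) needs a chain (`ReflexQuarterPocketChains`).
* §1 `mem_rqp_iff`, `rqp_cyl`, **`mem_rqp_of_ne`** (NE-closedness), `mem_rqp_of_armNeg`, `rqp_station_props`; §2 **`rqp_design_faces`**.
[cite: AizenmanChayesChayesFrohlichRusso1983, §4 Thm 4.4, Lemma 4.2 (a), Lemma 4.3] [cite: DuminilCopinSidoraviciusTassion2016, Thm. 1 and §2] -/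

noncomputable section

namespace Summit.CriticalPhenomena.PercolationContinuityZ3.Theorems.Transplant

namespace ReflexQuarterPocket

open MeasureTheory Literature.Probability.Percolation Literature.Probability.LatticeModels SimpleGraph HSU OrthantUniq HalfSlabUniq
  ConeSlabUniq SectorSlab RationalHalfSlab Filter
open scoped Classical Topology

variable {k m : ℕ} {N : ℕ} {κW κS : ℝ}

/-! ## §1 The quadrant-with-pockets sector-slab -/

/-- Membership. [folklore] -/
theorem mem_rqp_iff {x : Site 3} :
    x ∈ {x : Site 3 | x ∈ slab 3 k ∧ ((0 ≤ x 2 ∨ -(x 2 : ℝ) ≤ κW * (x 1 : ℝ)) ∧ (0 ≤ x 1 ∨ -(x 1 : ℝ) ≤ κS * (x 2 : ℝ)))} ↔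
      (0 ≤ x 0 ∧ x 0 ≤ (k : ℤ)) ∧ ((0 ≤ x 2 ∨ -(x 2 : ℝ) ≤ κW * (x 1 : ℝ)) ∧ (0 ≤ x 1 ∨ -(x 1 : ℝ) ≤ κS * (x 2 : ℝ))) := Iff.rfl

/-- The domain is cylindrical. [folklore] -/
theorem rqp_cyl : ∀ x ∈ {x : Site 3 | x ∈ slab 3 k ∧ ((0 ≤ x 2 ∨ -(x 2 : ℝ) ≤ κW * (x 1 : ℝ)) ∧ (0 ≤ x 1 ∨ -(x 1 : ℝ) ≤ κS * (x 2 : ℝ)))},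
    ∀ y ∈ slab 3 k, y 1 = x 1 → y 2 = x 2 →
    y ∈ {x : Site 3 | x ∈ slab 3 k ∧ ((0 ≤ x 2 ∨ -(x 2 : ℝ) ≤ κW * (x 1 : ℝ)) ∧ (0 ≤ x 1 ∨ -(x 1 : ℝ) ≤ κS * (x 2 : ℝ)))} := by
  intro x hx y hy h1 h2
  exact ⟨hy, by rw [h1, h2]; exact hx.2⟩

/-- The domain lies in the slab. [folklore] -/
theorem rqp_subset_slab :
    {x : Site 3 | x ∈ slab 3 k ∧ ((0 ≤ x 2 ∨ -(x 2 : ℝ) ≤ κW * (x 1 : ℝ)) ∧ (0 ≤ x 1 ∨ -(x 1 : ℝ) ≤ κS * (x 2 : ℝ)))} ⊆ slab 3 k :=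
  fun _ hx => hx.1

/-- **`ℚℙ` is closed under `+e₁, +e₂`**: `b ∈ ℚℙ`, `b₁ ≤ x₁`, `b₂ ≤ x₂` ⇒ `x ∈ ℚℙ` (`κW, κS ≥ 0`). [folklore] -/
theorem mem_rqp_of_ne (hκW : 0 ≤ κW) (hκS : 0 ≤ κS) {b x : Site 3}
    (hb : b ∈ {x : Site 3 | x ∈ slab 3 k ∧ ((0 ≤ x 2 ∨ -(x 2 : ℝ) ≤ κW * (x 1 : ℝ)) ∧ (0 ≤ x 1 ∨ -(x 1 : ℝ) ≤ κS * (x 2 : ℝ)))})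
    (hx0 : x ∈ slab 3 k) (h1 : b 1 ≤ x 1) (h2 : b 2 ≤ x 2) :
    x ∈ {x : Site 3 | x ∈ slab 3 k ∧ ((0 ≤ x 2 ∨ -(x 2 : ℝ) ≤ κW * (x 1 : ℝ)) ∧ (0 ≤ x 1 ∨ -(x 1 : ℝ) ≤ κS * (x 2 : ℝ)))} := by
  obtain ⟨-, hbW, hbS⟩ := hb
  have h1r : (b 1 : ℝ) ≤ (x 1 : ℝ) := by exact_mod_cast h1
  have h2r : (b 2 : ℝ) ≤ (x 2 : ℝ) := by exact_mod_cast h2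
  refine ⟨hx0, ?_, ?_⟩
  · by_cases hx2 : 0 ≤ x 2
    · exact Or.inl hx2
    · rcases hbW with h | h
      · exfalso; omega
      · exact Or.inr (by have := mul_le_mul_of_nonneg_left h1r hκW; linarith)
  · by_cases hx1 : 0 ≤ x 1
    · exact Or.inl hx1
    · rcases hbS with h | h
      · exfalso; omega
      · exact Or.inr (by have := mul_le_mul_of_nonneg_left h2r hκS; linarith)

/-- **Arms leaning `−e₂` from a left-face exit `b` (`b₁ ≥ 0`, `−b₂ ≤ κW b₁`) stay in `ℚℙ`** (slope `1/(4m)`, `4m·κW ≥ 1`): `0 ≤ b₂ − x₂`,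
`4m(b₂ − x₂) ≤ x₁ − b₁`. [folklore] -/
theorem mem_rqp_of_armNeg (hmW : 1 ≤ 4 * (m : ℝ) * κW) {b x : Site 3} (hb1 : 0 ≤ b 1) (hbW : -(b 2 : ℝ) ≤ κW * (b 1 : ℝ)) (hx0 : x ∈ slab 3 k)
    (h1 : 0 ≤ (-1 : ℤ) * (x 2 - b 2)) (h2 : 4 * (m : ℤ) * ((-1 : ℤ) * (x 2 - b 2)) ≤ x 1 - b 1) :
    x ∈ {x : Site 3 | x ∈ slab 3 k ∧ ((0 ≤ x 2 ∨ -(x 2 : ℝ) ≤ κW * (x 1 : ℝ)) ∧ (0 ≤ x 1 ∨ -(x 1 : ℝ) ≤ κS * (x 2 : ℝ)))} := by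
  rw [neg_one_mul] at h1 h2
  have h1r : (0 : ℝ) ≤ (b 2 : ℝ) - (x 2 : ℝ) := by
    have : 0 ≤ b 2 - x 2 := by linarith
    exact_mod_cast this
  have h2r : 4 * (m : ℝ) * ((b 2 : ℝ) - (x 2 : ℝ)) ≤ (x 1 : ℝ) - (b 1 : ℝ) := by
    have : 4 * (m : ℤ) * (b 2 - x 2) ≤ x 1 - b 1 := by linarith
    exact_mod_cast this
  have hm0 : (0 : ℝ) ≤ 4 * (m : ℝ) := by positivity
  have hd : (0 : ℝ) ≤ (x 1 : ℝ) - (b 1 : ℝ) := le_trans (mul_nonneg hm0 h1r) h2r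
  have hb1r : (0 : ℝ) ≤ (b 1 : ℝ) := by exact_mod_cast hb1
  have hκW : 0 ≤ κW := by nlinarith
  have hx1r : (0 : ℝ) ≤ (x 1 : ℝ) := by linarith
  refine ⟨hx0, Or.inr ?_, Or.inl (by exact_mod_cast hx1r)⟩
  have e1 : 1 * ((b 2 : ℝ) - (x 2 : ℝ)) ≤ (4 * (m : ℝ) * κW) * ((b 2 : ℝ) - (x 2 : ℝ)) := mul_le_mul_of_nonneg_right hmW h1r
  have e2 : κW * (4 * (m : ℝ) * ((b 2 : ℝ) - (x 2 : ℝ))) ≤ κW * ((x 1 : ℝ) - (b 1 : ℝ)) := mul_le_mul_of_nonneg_left h2r hκW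
  nlinarith

/-! ## §2 The design -/

/-- **The station's region**: `Ω = (0, m(4N+6), −(4N+6))`, `Z = (m+2)(2N+4)`, top `T = m(5N+8) + 4N+7` (`m ≥ 1`, `mκW ≥ 1`): inside `ℚℙ` (NW
pocket or NE quadrant: `|x₂| ≤ 4N+6 ≤ κW·m(4N+6) ≤ κW x₁`), off the box, below `T`. [folklore] -/
theorem rqp_station_props (hκW : 0 < κW) (hm : 1 ≤ m) (hmW : 1 ≤ (m : ℝ) * κW) {x : Site 3}
    (hx : x ∈ shallowReg k ![0, (m : ℤ) * (4 * (N : ℤ) + 6), -(4 * (N : ℤ) + 6)] (((m : ℤ) + 2) * (2 * (N : ℤ) + 4))) :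
    x ∈ {x : Site 3 | x ∈ slab 3 k ∧ ((0 ≤ x 2 ∨ -(x 2 : ℝ) ≤ κW * (x 1 : ℝ)) ∧ (0 ≤ x 1 ∨ -(x 1 : ℝ) ≤ κS * (x 2 : ℝ)))} ∧ x ∉ boxSet 3 N ∧
      x 1 ≤ (m : ℤ) * (5 * (N : ℤ) + 8) + 4 * (N : ℤ) + 7 := by
  obtain ⟨h0, h1, h2, h3, hZ⟩ := shallowReg_props hx
  simp only [Matrix.cons_val_one, Matrix.cons_val_zero, Matrix.cons_val] at h1 h2 h3
  have hm1 : (1 : ℤ) ≤ (m : ℤ) := by exact_mod_cast hm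
  have hmZ : (1 : ℤ) * (4 * (N : ℤ) + 6) ≤ (m : ℤ) * (4 * (N : ℤ) + 6) := mul_le_mul_of_nonneg_right hm1 (by positivity)
  have h1r : (m : ℝ) * (4 * (N : ℝ) + 6) ≤ (x 1 : ℝ) := by exact_mod_cast h1
  have h3r : -(4 * (N : ℝ) + 6) ≤ (x 2 : ℝ) := by exact_mod_cast h3
  have e1 : κW * ((m : ℝ) * (4 * (N : ℝ) + 6)) ≤ κW * (x 1 : ℝ) := mul_le_mul_of_nonneg_left h1r hκW.le
  have e2 : (1 : ℝ) * (4 * (N : ℝ) + 6) ≤ ((m : ℝ) * κW) * (4 * (N : ℝ) + 6) := mul_le_mul_of_nonneg_right hmW (by positivity)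
  refine ⟨⟨h0, Or.inr (by nlinarith), Or.inl (by omega)⟩, not_mem_boxSet_of_lt (j := 1) (by rw [abs_of_nonneg (by omega)]; omega), ?_⟩
  obtain ⟨P, hP⟩ : ∃ P : ℤ, P = (m : ℤ) * (N : ℤ) := ⟨_, rfl⟩
  have e3 : (m : ℤ) * (4 * (N : ℤ) + 6) = 4 * P + 6 * (m : ℤ) := by rw [hP]; ring
  have e4 : ((m : ℤ) + 2) * (2 * (N : ℤ) + 4) = 2 * P + 4 * (m : ℤ) + 4 * (N : ℤ) + 8 := by rw [hP]; ring
  have e5 : (m : ℤ) * (5 * (N : ℤ) + 8) = 5 * P + 8 * (m : ℤ) := by rw [hP]; ring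
  rw [e3] at h2; rw [e4] at hZ; rw [e5]
  linarith

/-- **The design at a top / right / left-face vertex of `ℚℙ`** (`κW, κS > 0`, `m ≥ 2`, `mκW ≥ 1`, `N ≥ k+1`; `α₄` an arm bound of slope
`1/(4m)` for both leanings, `A` a slab arm kit at `p'`, `αₛ ≤ 1` the swapped-arm bound carried for uniformity): an increasing event, measurable,
determined by the edges of `[-M,M]³` (`M = k + (m+2)(5N+8)`), of `P_{p'} ≥ α₄·α·αₛ`, on which `≤ 2k + 2` extra open edges join `u` to the station
`Ω = (0, m(4N+6), −(4N+6))` through open exterior steps of `ℚℙ`.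
[cite: AizenmanChayesChayesFrohlichRusso1983, §4 Cor. to Lemma 4.3, Lemma 4.2 (a)] -/
theorem rqp_design_faces (hκW : 0 < κW) (hκS : 0 < κS) (hm : 2 ≤ m) (hmW : 1 ≤ (m : ℝ) * κW) (hN : k + 1 ≤ N)
    {p' : unitInterval} (A : SlabArmKit k p') {α₄ αₛ : ℝ} (hα₄ : 0 < α₄) (hαₛ1 : αₛ ≤ 1)
    (harm : ∀ σ : ℤ, (σ = 1 ∨ σ = -1) → ∀ b : Site 3, b ∈ slab 3 k →
      α₄ ≤ (bondPercolation (zdGraph 3) p').real (percolatesVia (withinGraph (zdGraph 3) (steepSetM (4 * m) k σ b)) b))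
    {u : Site 3} (hu : u ∈ boxSet 3 N)
    (huP : u ∈ {x : Site 3 | x ∈ slab 3 k ∧ ((0 ≤ x 2 ∨ -(x 2 : ℝ) ≤ κW * (x 1 : ℝ)) ∧ (0 ≤ x 1 ∨ -(x 1 : ℝ) ≤ κS * (x 2 : ℝ)))})
    (hface : (u 1 = N ∧ u + Pi.single 1 1 ∈
        {x : Site 3 | x ∈ slab 3 k ∧ ((0 ≤ x 2 ∨ -(x 2 : ℝ) ≤ κW * (x 1 : ℝ)) ∧ (0 ≤ x 1 ∨ -(x 1 : ℝ) ≤ κS * (x 2 : ℝ)))}) ∨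
      (u 2 = N ∧ u + Pi.single 2 1 ∈
        {x : Site 3 | x ∈ slab 3 k ∧ ((0 ≤ x 2 ∨ -(x 2 : ℝ) ≤ κW * (x 1 : ℝ)) ∧ (0 ≤ x 1 ∨ -(x 1 : ℝ) ≤ κS * (x 2 : ℝ)))}) ∨
      (u 2 = -(N : ℤ) ∧ u - Pi.single 2 1 ∈
        {x : Site 3 | x ∈ slab 3 k ∧ ((0 ≤ x 2 ∨ -(x 2 : ℝ) ≤ κW * (x 1 : ℝ)) ∧ (0 ≤ x 1 ∨ -(x 1 : ℝ) ≤ κS * (x 2 : ℝ)))})) :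
    ∃ E : Set (BondConfig (Site 3)), IsUpperSet E ∧ MeasurableSet E ∧
      DeterminedBy E ↑(edgesIn (zdGraph 3) (box 3 (k + (m + 2) * (5 * N + 8)))) ∧
      α₄ * A.α * αₛ ≤ (bondPercolation (zdGraph 3) p').real E ∧
      ∀ ω ∈ E, ∃ F : Finset (Sym2 (Site 3)), F ⊆ edgesIn (zdGraph 3) (box 3 (k + (m + 2) * (5 * N + 8))) ∧ F.card ≤ 2 * k + 2 ∧
        ω ∪ ↑F ∈ openConnVia (starGraph (withinGraph (zdGraph 3)
          {x : Site 3 | x ∈ slab 3 k ∧ ((0 ≤ x 2 ∨ -(x 2 : ℝ) ≤ κW * (x 1 : ℝ)) ∧ (0 ≤ x 1 ∨ -(x 1 : ℝ) ≤ κS * (x 2 : ℝ)))}) Set.univ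
          (boxSet 3 N)) u ![0, (m : ℤ) * (4 * (N : ℤ) + 6), -(4 * (N : ℤ) + 6)] := by
  have hu0 : 0 ≤ u 0 ∧ u 0 ≤ (k : ℤ) := huP.1
  have hub := mem_boxSet_iff.1 hu
  have hu1 := hub 1; have hu2 := hub 2
  have hm1 : (1 : ℤ) ≤ (m : ℤ) := by exact_mod_cast (le_trans (by norm_num) hm)
  have hm2 : (2 : ℤ) ≤ (m : ℤ) := by exact_mod_cast hm
  have h4m0 : (0 : ℤ) < 4 * (m : ℤ) := by linarith
  have hmW' : 1 ≤ 4 * (m : ℝ) * κW := by nlinarith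
  -- constants, written linearly in the monomial `P = m·N`
  obtain ⟨P, hP⟩ : ∃ P : ℤ, P = (m : ℤ) * (N : ℤ) := ⟨_, rfl⟩
  have hP2 : 2 * (N : ℤ) ≤ P := by rw [hP]; exact mul_le_mul_of_nonneg_right hm2 (by positivity)
  have hP0 : 0 ≤ P := by linarith [show (0 : ℤ) ≤ (N : ℤ) by positivity]
  obtain ⟨Z, hZ⟩ : ∃ Z : ℤ, Z = ((m : ℤ) + 2) * (2 * (N : ℤ) + 4) := ⟨_, rfl⟩
  obtain ⟨Y, hY⟩ : ∃ Y : ℤ, Y = (m : ℤ) * (4 * (N : ℤ) + 6) := ⟨_, rfl⟩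
  obtain ⟨T, hT⟩ : ∃ T : ℤ, T = (m : ℤ) * (5 * (N : ℤ) + 8) + 4 * (N : ℤ) + 7 := ⟨_, rfl⟩
  have hZex : Z = 2 * P + 4 * (m : ℤ) + 4 * (N : ℤ) + 8 := by rw [hZ, hP]; ring
  have hYex : Y = 4 * P + 6 * (m : ℤ) := by rw [hY, hP]; ring
  have hTex : T = 5 * P + 8 * (m : ℤ) + 4 * (N : ℤ) + 7 := by rw [hT, hP]; ring
  have h4mex : 4 * (m : ℤ) * (2 * (N : ℤ) + 4) = 8 * P + 16 * (m : ℤ) := by rw [hP]; ring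
  have hMcast : ((k + (m + 2) * (5 * N + 8) : ℕ) : ℤ) = (k : ℤ) + 5 * P + 8 * (m : ℤ) + 10 * (N : ℤ) + 16 := by push_cast; rw [hP]; ring
  have hTN : T + (N : ℤ) < 4 * (m : ℤ) * (2 * (N : ℤ) + 4) := by rw [h4mex, hTex]; linarith
  have hTlo : (N : ℤ) + 1 ≤ T := by rw [hTex]; linarith
  have hZlo : 8 * (N : ℤ) + 16 ≤ Z := by rw [hZex]; linarith
  have hYlo : 4 * (N : ℤ) + 6 ≤ Y := by rw [hYex]; linarith
  set Ω : Site 3 := ![0, (m : ℤ) * (4 * (N : ℤ) + 6), -(4 * (N : ℤ) + 6)] with hΩ_def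
  have hΩ0 : Ω 0 = 0 := by simp [hΩ_def]
  have hΩ1 : Ω 1 = Y := by simp [hΩ_def, hY]
  have hΩ2 : Ω 2 = -(4 * (N : ℤ) + 6) := by simp [hΩ_def]
  have hΩslab : Ω ∈ slab 3 k := by show 0 ≤ Ω 0 ∧ Ω 0 ≤ (k : ℤ); rw [hΩ0]; exact ⟨le_rfl, by positivity⟩
  have hH : ∀ x ∈ shallowReg k Ω Z,
      x ∈ {x : Site 3 | x ∈ slab 3 k ∧ ((0 ≤ x 2 ∨ -(x 2 : ℝ) ≤ κW * (x 1 : ℝ)) ∧ (0 ≤ x 1 ∨ -(x 1 : ℝ) ≤ κS * (x 2 : ℝ)))} ∧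
        x ∉ boxSet 3 N ∧ x 1 ≤ T := fun x hx => by
    rw [hT]; rw [hZ] at hx; exact rqp_station_props hκW (le_trans (by norm_num) hm) hmW hx
  have hwinH : ∀ x ∈ shallowReg k Ω Z, ∀ j, |x j| ≤ (k + (m + 2) * (5 * N + 8) : ℕ) := by
    intro x hx j
    rw [hMcast]
    obtain ⟨h0, h1, h2, h3, hZ'⟩ := shallowReg_props hx
    have hxT := (hH x hx).2.2
    rw [hΩ1, hYex] at h1; rw [hΩ2] at h3; rw [hTex] at hxT; rw [hZex] at hZ'
    fin_cases j <;> rw [abs_le] <;> constructor <;> simp <;> linarith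
  have hq0 : 0 ≤ α₄ * A.α := (mul_pos hα₄ A.α_pos).le
  -- generic packaging: apex `b` adjacent to `u`, off the box, `−N ≤ b₁ ≤ N+1`, `|b₂| ≤ N+1`; arm `steepSetM (4m) k σ b` in `ℚℙ` and off the box
  have pack : ∀ {σ : ℤ} (_ : σ = 1 ∨ σ = -1) {b : Site 3}
      (_ : b ∈ {x : Site 3 | x ∈ slab 3 k ∧ ((0 ≤ x 2 ∨ -(x 2 : ℝ) ≤ κW * (x 1 : ℝ)) ∧ (0 ≤ x 1 ∨ -(x 1 : ℝ) ≤ κS * (x 2 : ℝ)))})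
      (_ : -(N : ℤ) ≤ b 1) (_ : b 1 ≤ (N : ℤ) + 1) (_ : |b 2| ≤ (N : ℤ) + 1) (_ : (zdGraph 3).Adj u b) (_ : b ∉ boxSet 3 N)
      (_ : ∀ x ∈ steepSetM (4 * m) k σ b ∩ {x | x 1 ≤ T},
        x ∈ {x : Site 3 | x ∈ slab 3 k ∧ ((0 ≤ x 2 ∨ -(x 2 : ℝ) ≤ κW * (x 1 : ℝ)) ∧ (0 ≤ x 1 ∨ -(x 1 : ℝ) ≤ κS * (x 2 : ℝ)))} ∧
          x ∉ boxSet 3 N),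
      ∃ E : Set (BondConfig (Site 3)), IsUpperSet E ∧ MeasurableSet E ∧
        DeterminedBy E ↑(edgesIn (zdGraph 3) (box 3 (k + (m + 2) * (5 * N + 8)))) ∧
        α₄ * A.α * αₛ ≤ (bondPercolation (zdGraph 3) p').real E ∧
        ∀ ω ∈ E, ∃ F : Finset (Sym2 (Site 3)), F ⊆ edgesIn (zdGraph 3) (box 3 (k + (m + 2) * (5 * N + 8))) ∧ F.card ≤ 2 * k + 2 ∧
          ω ∪ ↑F ∈ openConnVia (starGraph (withinGraph (zdGraph 3)
            {x : Site 3 | x ∈ slab 3 k ∧ ((0 ≤ x 2 ∨ -(x 2 : ℝ) ≤ κW * (x 1 : ℝ)) ∧ (0 ≤ x 1 ∨ -(x 1 : ℝ) ≤ κS * (x 2 : ℝ)))})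
            Set.univ (boxSet 3 N)) u Ω := by
    intro σ hσ b hbP hb1lo hb1hi hb2 hadj hbbox hSD
    have hb2' := abs_le.1 hb2
    have hbslab : b ∈ slab 3 k := hbP.1
    set S : Set (Site 3) := steepSetM (4 * m) k σ b ∩ {x | x 1 ≤ T} with hS_def
    have hbS : b ∈ S := ⟨self_mem_steepSetM hbslab, by show b 1 ≤ T; linarith⟩
    have hSprops : ∀ x ∈ S, (0 ≤ x 0 ∧ x 0 ≤ (k : ℤ)) ∧ b 1 ≤ x 1 ∧ x 1 ≤ T ∧ 0 ≤ σ * (x 2 - b 2) ∧ σ * (x 2 - b 2) ≤ 2 * (N : ℤ) + 3 := by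
      rintro x ⟨⟨h0, h1, h2⟩, hxT⟩
      have hxT' : x 1 ≤ T := hxT
      push_cast at h2
      have hA : (0 : ℤ) ≤ 4 * (m : ℤ) * (σ * (x 2 - b 2)) := mul_nonneg h4m0.le h1
      have hsp : σ * (x 2 - b 2) < 2 * (N : ℤ) + 4 := by
        refine lt_of_mul_lt_mul_left ?_ h4m0.le
        calc 4 * (m : ℤ) * (σ * (x 2 - b 2)) ≤ x 1 - b 1 := h2
          _ ≤ T + (N : ℤ) := by linarith
          _ < 4 * (m : ℤ) * (2 * (N : ℤ) + 4) := hTN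
      exact ⟨h0, by linarith, hxT', h1, by omega⟩
    have hSz : ∀ x ∈ S, Ω 2 ≤ x 2 ∧ x 2 ≤ Z := fun x hx => by
      obtain ⟨-, -, -, h3, h4⟩ := hSprops x hx
      rw [hΩ2]
      rcases hσ with rfl | rfl
      · rw [one_mul] at h3 h4; constructor <;> linarith
      · rw [neg_one_mul] at h3 h4; constructor <;> linarith
    have hM : ∀ x ∈ S ∪ shallowReg k Ω Z, ∀ j, |x j| ≤ (k + (m + 2) * (5 * N + 8) : ℕ) := by
      rintro x (hx | hx) j
      · rw [hMcast]
        obtain ⟨h0, h1, h2, -, -⟩ := hSprops x hx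
        obtain ⟨h3, h4⟩ := hSz x hx
        rw [hΩ2] at h3; rw [hTex] at h2; rw [hZex] at h4
        fin_cases j <;> rw [abs_le] <;> constructor <;> simp <;> linarith
      · exact hwinH x hx j
    set E : Set (BondConfig (Site 3)) := reachEvent (withinGraph (zdGraph 3) S) b {x | x 1 = T} ∩
      reachEvent (withinGraph (zdGraph 3) (shallowReg k Ω Z)) Ω {x | x 2 = Z} with hE
    have hSfin : S.Finite := (boxSet_finite _).subset (subset_boxSet_of_abs_le fun x hx => hM x (Or.inl hx))
    have hprobS : α₄ ≤ (bondPercolation (zdGraph 3) p').real (reachEvent (withinGraph (zdGraph 3) S) b {x | x 1 = T}) :=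
      le_real_of_subset (percolatesVia_subset_reachEvent_le (self_mem_steepSetM hbslab) 1 (by linarith)
        (by simpa [hS_def] using hSfin)) (harm σ hσ b hbslab)
    have hprobH : A.α ≤ (bondPercolation (zdGraph 3) p').real
        (reachEvent (withinGraph (zdGraph 3) (shallowReg k Ω Z)) Ω {x | x 2 = Z}) :=
      le_real_of_subset (percolatesVia_subset_reachEvent_le (self_mem_shallowSet hΩslab) 2 (by rw [hΩ2]; linarith)
        (by simpa only [HalfSlabUniq.shallowReg] using shallowReg_finite (k := k) Ω Z)) (A.shallow_arm Ω hΩslab)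
    refine ⟨E, (isUpperSet_reachEvent _ _ _).inter (isUpperSet_reachEvent _ _ _),
      (measurableSet_reachEvent _ _ _).inter (measurableSet_reachEvent _ _ _), ?_, ?_, fun ω hω => ?_⟩
    · exact ((determinedBy_reachEvent _ _ _).mono (edgeSet_withinGraph_subset_edgesIn (subset_boxSet_of_abs_le fun x hx =>
        hM x (Or.inl hx)))).inter ((determinedBy_reachEvent _ _ _).mono (edgeSet_withinGraph_subset_edgesIn
          (subset_boxSet_of_abs_le fun x hx => hM x (Or.inr hx))))
    · exact (mul_le_of_le_one_right hq0 hαₛ1).trans (harris2_of_le p' (isUpperSet_reachEvent _ _ _) (isUpperSet_reachEvent _ _ _)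
        (measurableSet_reachEvent _ _ _) (measurableSet_reachEvent _ _ _) hα₄.le hprobS hprobH)
    · obtain ⟨F, hFs, hFc, hFr⟩ := move_apex_cyl_region
        (D := {x : Site 3 | x ∈ slab 3 k ∧ ((0 ≤ x 2 ∨ -(x 2 : ℝ) ≤ κW * (x 1 : ℝ)) ∧ (0 ≤ x 1 ∨ -(x 1 : ℝ) ≤ κS * (x 2 : ℝ)))})
        (by omega) rqp_cyl (S := S) (fun x hx => (hSprops x hx).1) hbS hΩslab (by rw [hΩ2]; linarith) (by rw [hΩ1]; linarith)
        (fun x hx => ⟨(hSD x hx).1, (hSD x hx).2, ⟨(hSprops x hx).2.1, (hSprops x hx).2.2.1⟩, hSz x hx⟩) hH hM hω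
      have hMN : N ≤ k + (m + 2) * (5 * N + 8) := by
        have : N ≤ (m + 2) * (5 * N + 8) := le_trans (by omega : N ≤ 5 * N + 8) (Nat.le_mul_of_pos_left _ (by omega))
        omega
      have hwu : ∀ j, |u j| ≤ (k + (m + 2) * (5 * N + 8) : ℕ) := abs_le_of_mem_boxSet hu hMN
      have hwb : ∀ j, |b j| ≤ (k + (m + 2) * (5 * N + 8) : ℕ) := hM b (Or.inl hbS)
      refine ⟨insert s(u, b) F, ?_, (Finset.card_insert_le _ _).trans (by omega), ?_⟩
      · intro e he
        rcases Finset.mem_insert.1 he with rfl | he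
        · exact mem_edgesIn_of_adj hadj hwu hwb
        · exact hFs he
      · exact openConnVia_step (dext_adj_of hadj huP hbP fun h' => hbbox h'.2) (Finset.mem_insert_self _ _)
          (openConnVia_mono_finset (Finset.subset_insert _ _) hFr)
  rcases hface with ⟨htop, hbD⟩ | ⟨hright, hbD⟩ | ⟨hleft, hbD⟩
  · -- TOP face: escape `u → b = u + e₁ ∈ ℚℙ`, lean `+e₂` (`ℚℙ` is closed under `+e₁, +e₂`)
    set b : Site 3 := u + Pi.single 1 1 with hb_def
    have hb1 : b 1 = (N : ℤ) + 1 := by simp [hb_def, htop]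
    have hb2 : b 2 = u 2 := by simp [hb_def]
    refine pack (Or.inl rfl) hbD (by rw [hb1]; omega) (by rw [hb1]) (by rw [hb2, abs_le]; constructor <;> omega)
      ((zdGraph_adj_iff _ _).2 ⟨1, Or.inl rfl⟩) (not_mem_boxSet_of_lt (j := 1) (by rw [hb1, abs_of_nonneg (by omega)]; omega))
      fun x hx => ?_
    obtain ⟨⟨h0, h1, h2⟩, -⟩ := hx
    rw [one_mul] at h1 h2
    push_cast at h2
    have : (0 : ℤ) ≤ 4 * (m : ℤ) * (x 2 - b 2) := mul_nonneg h4m0.le h1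
    exact ⟨mem_rqp_of_ne hκW.le hκS.le hbD h0 (by linarith) (by linarith),
      not_mem_boxSet_of_lt (j := 1) (by rw [abs_of_nonneg (by linarith)]; linarith)⟩
  · -- RIGHT face: escape `u → b = u + e₂ ∈ ℚℙ`, lean `+e₂`
    set b : Site 3 := u + Pi.single 2 1 with hb_def
    have hb1 : b 1 = u 1 := by simp [hb_def]
    have hb2 : b 2 = (N : ℤ) + 1 := by simp [hb_def, hright]
    refine pack (Or.inl rfl) hbD (by rw [hb1]; omega) (by rw [hb1]; omega) (by rw [hb2, abs_of_nonneg (by positivity)])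
      ((zdGraph_adj_iff _ _).2 ⟨2, Or.inl rfl⟩) (not_mem_boxSet_of_lt (j := 2) (by rw [hb2, abs_of_nonneg (by omega)]; omega))
      fun x hx => ?_
    obtain ⟨⟨h0, h1, h2⟩, -⟩ := hx
    rw [one_mul] at h1 h2
    push_cast at h2
    have : (0 : ℤ) ≤ 4 * (m : ℤ) * (x 2 - b 2) := mul_nonneg h4m0.le h1
    exact ⟨mem_rqp_of_ne hκW.le hκS.le hbD h0 (by linarith) (by linarith),
      not_mem_boxSet_of_lt (j := 2) (by rw [abs_of_nonneg (by linarith)]; linarith)⟩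
  · -- LEFT face (NW pocket, `κW u₁ ≥ N+1`): escape `u → b = u − e₂ ∈ ℚℙ`, lean `−e₂` with slope `1/(4m) ≤ κW/4`
    set b : Site 3 := u - Pi.single 2 1 with hb_def
    have hb1 : b 1 = u 1 := by simp [hb_def]
    have hb2 : b 2 = -(N : ℤ) - 1 := by simp [hb_def, hleft]
    have hbW : -(b 2 : ℝ) ≤ κW * (b 1 : ℝ) := by
      rcases hbD.2.1 with h | h
      · exfalso; rw [hb2] at h; omega
      · exact h
    have hb1pos : 0 ≤ b 1 := by
      by_contra hneg
      push Not at hneg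
      have h1r : (b 1 : ℝ) ≤ 0 := by exact_mod_cast hneg.le
      have h2r : -(b 2 : ℝ) = (N : ℝ) + 1 := by rw [hb2]; push_cast; ring
      have : κW * (b 1 : ℝ) ≤ 0 := mul_nonpos_iff.2 (Or.inl ⟨hκW.le, h1r⟩)
      have hN0 : (0 : ℝ) ≤ (N : ℝ) := by positivity
      linarith
    refine pack (Or.inr rfl) hbD (by rw [hb1]; omega) (by rw [hb1]; omega) (by rw [hb2, abs_le]; constructor <;> omega)
      ((zdGraph_adj_iff _ _).2 ⟨2, Or.inr (by rw [hb_def, sub_add_cancel])⟩)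
      (not_mem_boxSet_of_lt (j := 2) (by rw [hb2, abs_of_nonpos (by omega)]; omega)) fun x hx => ?_
    obtain ⟨⟨h0, h1, h2⟩, -⟩ := hx
    push_cast at h2
    refine ⟨mem_rqp_of_armNeg hmW' hb1pos hbW h0 h1 h2, not_mem_boxSet_of_lt (j := 2) ?_⟩
    rw [neg_one_mul, hb2] at h1
    rw [abs_of_nonpos (by linarith)]; linarith

end ReflexQuarterPocket

end Summit.CriticalPhenomena.PercolationContinuityZ3.Theorems.Transplant

end
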